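import Literature.AlgebraicTopology.Homotopy.WhiteheadCWContractible
import HarnessLib

/-!
# Lifting maps out of CW complexes through an ∞-connected map, up to homotopy

Topic `Literature/AlgebraicTopology/Homotopy`. The cell-by-cell technique of Hatcher's
compression and extension lemmas (*Algebraic Topology* (2002), Lemma 4.6, Lemma 4.7, proof of
Prop. 4.22; "HELP" in May, *A Concise Course in Algebraic Topology*, Ch. 10 §3), in the form
needed for Whitehead's theorem (Hatcher Thm. 4.5 / Miller Thm. 46.9, the named fact
`Literature.AlgebraicTopology.Homotopy.whitehead_exists_homotopyEquiv_of_isWeakHomotopyEquiv`), all PROVED: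

* `Literature.AlgebraicTopology.Homotopy.CWLift.BallLift f n`: the map `f : X → Y` *lifts `n`-balls rel boundary up to
  homotopy*: for every `ξ : ∂Dⁿ → X` and `c : Dⁿ → Y` with `c|∂Dⁿ = f ∘ ξ` there are an
  extension `Ξ : Dⁿ → X` of `ξ` and a homotopy rel `∂Dⁿ` from `c` to `f ∘ Ξ` (`Dⁿ` the closed
  unit ball of `ℝⁿ` in the sup norm, Mathlib's cell model; partial maps as total functions with
  `ContinuousOn` hypotheses, as in `WhiteheadCWContractible.lean`). For `n = 0` this says that
  every point of `Y` is joined by a path to a point of `f(X)`. (An `n`-connected map in the sense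
  of tom Dieck / May has `BallLift f k` for `k ≤ n`; a weak homotopy equivalence has all of them —
  proved in the sibling file `CubeLifting.lean`.)
* `Literature.AlgebraicTopology.Homotopy.CWLift.exists_lift_homotopic`: **if `f` lifts all balls, every map `u : K → Y` from a
  Hausdorff CW complex `K` lifts through `f` up to homotopy**: `∃ g : C(K, X), f ∘ g ≃ u`
  (Hatcher 2002, proof of Prop. 4.22 via Lemma 4.6: surjectivity of `f ∘ - : [K, X] → [K, Y]`).

## Proof

The skeletal induction of `WhiteheadCWContractible.lean` (whose box filling
`WhiteheadCW.boxFill`, time scale `WhiteheadCW.tau` and weak-topology lemma are reused), now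
carrying two pieces of data: a partial lift `g` (on the cells of dimension `< n`) and a homotopy
`H` from `u` to `f ∘ g`, stationary `= f ∘ g` on each closed `m`-cell from time
`τₘ₊₁ = 1 - 2⁻⁽ᵐ⁺²⁾` on. For an `n`-cell with characteristic map `Φ : D → K`: fill the box
`D × [0, τₙ]` from the bottom `u ∘ Φ` and the sides `H ∘ (Φ × id)` by radial projection; the top
slice `c` is a map `D → Y` with `c|∂D = f ∘ g ∘ Φ`; `BallLift f n` provides `Ξ : D → X`
extending `g ∘ Φ|∂D` and a homotopy rel `∂D` from `c` to `f ∘ Ξ`, which is run during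
`[τₙ, τₙ₊₁]`; set `g := Ξ ∘ Φ⁻¹` on the cell. Points are never changed after the stage of their
open cell, so the stages stabilise to `g : K → X` and `H : u ≃ f ∘ g`, continuous on closed cells
(the characteristic map of a compact cube onto a Hausdorff closed cell is a quotient map) and
hence continuous (weak topology).

## References

* A. Hatcher, *Algebraic Topology*, CUP (2002), §4.1, Lemma 4.6 (compression lemma), Lemma 4.7,
  Prop. 4.22 (p. 357). [HatcherAT2002]
-/

noncomputable section

open Set Metric Topology unitInterval Function
open scoped Topology ContinuousMap

namespace Literature.AlgebraicTopology.Homotopy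

namespace CWLift

variable {X Y : Type*} [TopologicalSpace X] [TopologicalSpace Y] (f : C(X, Y))

/-! ### Lifting balls rel boundary up to homotopy -/

/-- **`f` lifts `n`-balls rel boundary up to homotopy** (the lifting/extension property of an
`n`-connected map for the pair `(Dⁿ, ∂Dⁿ)`; Hatcher 2002, Lemma 4.6 with `(X, A) = (Dⁿ, ∂Dⁿ)`,
in the language of a map `f` instead of a pair): for every `ξ : ℝⁿ → X` continuous on the unit
sphere `∂Dⁿ` (sup norm) and `c : ℝⁿ → Y` continuous on the closed unit ball `Dⁿ` with
`c = f ∘ ξ` on `∂Dⁿ`, there are `Ξ : ℝⁿ → X` continuous on `Dⁿ` with `Ξ = ξ` on `∂Dⁿ`, and a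
homotopy `Γ : ℝⁿ × ℝ → Y`, continuous on `Dⁿ × [0, 1]`, from `c` (time `0`) to `f ∘ Ξ` (time
`1`), stationary `= c` on `∂Dⁿ`. (This is the standard relative lifting property by which
`n`-connected maps are characterised, e.g. May, *A Concise Course*, Ch. 10 §3 "HELP"; it is the
hypothesis actually consumed by the cell-by-cell argument of Hatcher's Lemma 4.6.) [folklore] -/
def BallLift (n : ℕ) : Prop :=
  ∀ (ξ : (Fin n → ℝ) → X) (c : (Fin n → ℝ) → Y),
    ContinuousOn ξ (sphere (0 : Fin n → ℝ) 1) → ContinuousOn c (closedBall (0 : Fin n → ℝ) 1) →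
    (∀ w ∈ sphere (0 : Fin n → ℝ) 1, c w = f (ξ w)) →
    ∃ (Ξ : (Fin n → ℝ) → X) (Γ : (Fin n → ℝ) × ℝ → Y),
      ContinuousOn Ξ (closedBall (0 : Fin n → ℝ) 1) ∧
      (∀ w ∈ sphere (0 : Fin n → ℝ) 1, Ξ w = ξ w) ∧
      ContinuousOn Γ (closedBall (0 : Fin n → ℝ) 1 ×ˢ Icc (0 : ℝ) 1) ∧
      (∀ w ∈ closedBall (0 : Fin n → ℝ) 1, Γ (w, 0) = c w) ∧
      (∀ w ∈ closedBall (0 : Fin n → ℝ) 1, Γ (w, 1) = f (Ξ w)) ∧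
      (∀ w ∈ sphere (0 : Fin n → ℝ) 1, ∀ t ∈ Icc (0 : ℝ) 1, Γ (w, t) = c w)

variable {f}

/-! ### The extension over one box -/

section BoxExtension

variable {n : ℕ}

/-- **Filling the box `D × [0, 1]` over a cell, with a lift of its far end**, GIVEN
`BallLift f n`: prescribed values `φ` on the bottom `D × {0}` and `h` on the sides
`∂D × [0, 1]`, the latter stationary `= f ∘ ξ` from time `τ` on (`ξ : ∂D → X`), extend to the
solid box, with value `f ∘ Ξ` from time `τ' > τ` on, for some `Ξ : D → X` extending `ξ`
(radial box filling up to time `τ`, then the homotopy provided by `BallLift` on `[τ, τ']`).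
[cite: HatcherAT2002, §4.1 Lemma 4.6] -/
theorem exists_box_extension (hf : BallLift f n) {τ τ' : ℝ} (hτ : 0 < τ) (hττ' : τ < τ')
    (hτ'1 : τ' ≤ 1)
    {φ : (Fin n → ℝ) → Y} (hφ : ContinuousOn φ (closedBall 0 1))
    {h : (Fin n → ℝ) × ℝ → Y} (hh : ContinuousOn h (sphere (0 : Fin n → ℝ) 1 ×ˢ Icc (0 : ℝ) 1))
    (h0 : ∀ w ∈ sphere (0 : Fin n → ℝ) 1, h (w, 0) = φ w)
    {ξ : (Fin n → ℝ) → X} (hξ : ContinuousOn ξ (sphere (0 : Fin n → ℝ) 1))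
    (hlate : ∀ w ∈ sphere (0 : Fin n → ℝ) 1, ∀ t ∈ Icc τ 1, h (w, t) = f (ξ w)) :
    ∃ (Ξ : (Fin n → ℝ) → X) (G : (Fin n → ℝ) × ℝ → Y),
      ContinuousOn Ξ (closedBall (0 : Fin n → ℝ) 1) ∧
      (∀ w ∈ sphere (0 : Fin n → ℝ) 1, Ξ w = ξ w) ∧
      ContinuousOn G (closedBall (0 : Fin n → ℝ) 1 ×ˢ Icc (0 : ℝ) 1) ∧
      (∀ w ∈ closedBall (0 : Fin n → ℝ) 1, G (w, 0) = φ w) ∧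
      (∀ w ∈ sphere (0 : Fin n → ℝ) 1, ∀ t ∈ Icc (0 : ℝ) 1, G (w, t) = h (w, t)) ∧
      (∀ w ∈ closedBall (0 : Fin n → ℝ) 1, ∀ t ∈ Icc τ' 1, G (w, t) = f (Ξ w)) := by
  have hτ1 : τ ≤ 1 := by linarith
  set G₁ := WhiteheadCW.boxFill τ φ h with hG₁def
  have hG₁ : ContinuousOn G₁ (closedBall (0 : Fin n → ℝ) 1 ×ˢ Icc (0 : ℝ) τ) :=
    WhiteheadCW.boxFill_continuousOn hτ hτ1 hφ hh h0
  -- the top slice `D × {τ}`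
  set c : (Fin n → ℝ) → Y := fun w => G₁ (w, τ) with hc
  have hcc : ContinuousOn c (closedBall (0 : Fin n → ℝ) 1) :=
    hG₁.comp (continuousOn_id.prodMk continuousOn_const) fun w hw => ⟨hw, hτ.le, le_rfl⟩
  have hcξ : ∀ w ∈ sphere (0 : Fin n → ℝ) 1, c w = f (ξ w) := fun w hw => by
    show G₁ (w, τ) = f (ξ w)
    rw [hG₁def, WhiteheadCW.boxFill_side hτ h0 hw ⟨hτ.le, le_rfl⟩]
    exact hlate w hw τ ⟨le_rfl, hτ1⟩
  obtain ⟨Ξ, Γ, hΞc, hΞξ, hΓc, hΓ0, hΓ1, hΓside⟩ := hf ξ c hξ hcc hcξ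
  -- time rescaling `[τ, τ'] → [0, 1]`
  set rescale : ℝ → ℝ := fun t => max 0 (min 1 ((t - τ) / (τ' - τ))) with hrescale
  have hrescalec : Continuous rescale := by
    refine continuous_const.max (continuous_const.min ?_)
    fun_prop
  have hrescale_mem : ∀ t, rescale t ∈ Icc (0 : ℝ) 1 := fun t =>
    ⟨le_max_left _ _, max_le zero_le_one (min_le_left _ _)⟩
  have hrescale0 : rescale τ = 0 := by
    simp only [hrescale, sub_self, zero_div]
    norm_num
  have hrescale1 : ∀ t, τ' ≤ t → rescale t = 1 := fun t ht => by
    have h1 : (1 : ℝ) ≤ (t - τ) / (τ' - τ) := by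
      rw [le_div_iff₀ (by linarith)]; linarith
    simp only [hrescale, min_eq_left h1]
    norm_num
  refine ⟨Ξ, fun p => if p.2 ≤ τ then G₁ p else Γ (p.1, rescale p.2), hΞc, hΞξ, ?_, ?_, ?_, ?_⟩
  · refine ContinuousOn.if ?_ ?_ ?_
    · rintro ⟨w, t⟩ ⟨⟨hw, -⟩, hfr⟩
      have ht : t = τ := frontier_le_subset_eq continuous_snd continuous_const hfr
      subst ht
      show G₁ (w, t) = Γ (w, rescale t)
      rw [hrescale0, hΓ0 w hw]
    · refine hG₁.mono ?_
      rintro ⟨w, t⟩ ⟨⟨hw, ht⟩, hcl⟩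
      rw [closure_le_eq continuous_snd continuous_const] at hcl
      exact ⟨hw, ht.1, hcl⟩
    · exact hΓc.comp (continuousOn_fst.prodMk (hrescalec.comp_continuousOn continuousOn_snd))
        fun p hp => ⟨hp.1.1, hrescale_mem _⟩
  · intro w hw
    simp only [hτ.le, if_true]
    exact WhiteheadCW.boxFill_bottom hτ hw
  · intro w hw t ht
    by_cases htτ : t ≤ τ
    · simp only [htτ, if_true]
      exact WhiteheadCW.boxFill_side hτ h0 hw ⟨ht.1, htτ⟩
    · simp only [htτ, if_false]
      rw [hΓside w hw _ (hrescale_mem t), hcξ w hw, hlate w hw t ⟨(not_le.1 htτ).le, ht.2⟩]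
  · intro w hw t ht
    have htτ : ¬ t ≤ τ := not_le.2 (lt_of_lt_of_le hττ' ht.1)
    simp only [htτ, if_false]
    rw [hrescale1 t ht.1, hΓ1 w hw]

end BoxExtension

/-! ### The skeletal induction -/

section CW

variable {K : Type*} [TopologicalSpace K] [T2Space K] [CWComplex (univ : Set K)]

open RelCWComplex

attribute [local instance] Classical.propDecidable

variable (f) (u : C(K, Y))

/-- Stage `n` of the lifting: a partial lift `g` and a homotopy `H` from `u` towards `f ∘ g`,
both defined (at least) on all closed cells of dimension `< n`; `H` starts at `u` and is
stationary `= f ∘ g` on each closed `m`-cell from time `WhiteheadCW.tau (m + 1)` on. [folklore] -/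
structure Stage (n : ℕ) where
  /-- the partial lift (only its values on closed cells of dimension `< n` matter) -/
  g : K → X
  /-- the homotopy, `H k t` (only `t ∈ [0, 1]` and `k` in a closed cell of dimension `< n`
  matter) -/
  H : K → ℝ → Y
  /-- continuity of the lift on each closed cell of dimension `< n` -/
  cont_g : ∀ m < n, ∀ j : cell (univ : Set K) m, ContinuousOn g (closedCell m j)
  /-- continuity of the homotopy on each closed cell of dimension `< n`, times `[0, 1]` -/
  cont : ∀ m < n, ∀ j : cell (univ : Set K) m,
    ContinuousOn (fun p : K × ℝ => H p.1 p.2) (closedCell m j ×ˢ Icc (0 : ℝ) 1)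
  /-- the homotopy starts at `u` -/
  zero : ∀ k, H k 0 = u k
  /-- on a closed `m`-cell the homotopy is stationary `= f ∘ g` from time `WhiteheadCW.tau (m + 1)` on -/
  late : ∀ m < n, ∀ j : cell (univ : Set K) m, ∀ k ∈ closedCell m j,
    ∀ t ∈ Icc (WhiteheadCW.tau (m + 1)) 1, H k t = f (g k)

/-- Stage `0`: nothing lifted yet (`g` arbitrary, `H` the constant homotopy at `u`). [folklore] -/
def stageZero [Nonempty X] : Stage f u 0 where
  g _ := Classical.arbitrary X
  H k _ := u k
  cont_g m hm := absurd hm (Nat.not_lt_zero m)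
  cont m hm := absurd hm (Nat.not_lt_zero m)
  zero _ := rfl
  late m hm := absurd hm (Nat.not_lt_zero m)

variable {f u} {n : ℕ}

namespace Stage

/-- The boundary of an `n`-cell lies in finitely many closed cells of lower dimension, on which a
stage-`n` lift and homotopy are continuous and the homotopy is over by time `WhiteheadCW.tau n`.
[folklore] -/
theorem exists_frontier_cover (s : Stage f u n) (j : cell (univ : Set K) n) :
    ∃ F : Set K, cellFrontier n j ⊆ F ∧ ContinuousOn s.g F ∧
      ContinuousOn (fun p : K × ℝ => s.H p.1 p.2) (F ×ˢ Icc (0 : ℝ) 1) ∧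
      (∀ k ∈ F, ∀ t ∈ Icc (WhiteheadCW.tau n) 1, s.H k t = f (s.g k)) := by
  obtain ⟨J, hJ⟩ := CWComplex.cellFrontier_subset_finite_closedCell (C := (univ : Set K)) n j
  have hTlt : ∀ p : ↥((Finset.range n).sigma J), p.1.1 < n := fun p => by
    have hp := p.2
    simp only [Finset.mem_sigma, Finset.mem_range] at hp
    exact hp.1
  refine ⟨⋃ p : ↥((Finset.range n).sigma J), closedCell p.1.1 p.1.2, ?_, ?_, ?_, ?_⟩
  · intro x hx
    have hx' := hJ hx
    simp only [mem_iUnion, exists_prop] at hx'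
    obtain ⟨m, hm, i, hi, hxi⟩ := hx'
    exact mem_iUnion.2 ⟨⟨⟨m, i⟩, Finset.mem_sigma.2 ⟨Finset.mem_range.2 hm, hi⟩⟩, hxi⟩
  · exact (locallyFinite_of_finite _).continuousOn_iUnion (fun p => isClosed_closedCell)
      fun p => s.cont_g _ (hTlt p) _
  · rw [iUnion_prod_const]
    exact (locallyFinite_of_finite _).continuousOn_iUnion
      (fun p => isClosed_closedCell.prod isClosed_Icc) fun p => s.cont _ (hTlt p) _
  · intro x hx t ht
    obtain ⟨p, hp⟩ := mem_iUnion.1 hx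
    exact s.late _ (hTlt p) _ x hp t ⟨(WhiteheadCW.tau_mono (hTlt p)).trans ht.1, ht.2⟩

/-- The side data `(w, t) ↦ Hₙ(Φⱼ w, t)` over the boundary sphere of an `n`-cell is continuous.
[folklore] -/
theorem side_continuousOn (s : Stage f u n) (j : cell (univ : Set K) n) :
    ContinuousOn (fun p : (Fin n → ℝ) × ℝ => s.H (map n j p.1) p.2)
      (sphere (0 : Fin n → ℝ) 1 ×ˢ Icc (0 : ℝ) 1) := by
  obtain ⟨F, hF, -, hc, -⟩ := s.exists_frontier_cover j
  have hm : ContinuousOn (fun p : (Fin n → ℝ) × ℝ => (map n j p.1, p.2))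
      (sphere (0 : Fin n → ℝ) 1 ×ˢ Icc (0 : ℝ) 1) :=
    (((RelCWComplex.continuousOn n j).mono sphere_subset_closedBall).comp continuousOn_fst
      (fun p hp => hp.1)).prodMk continuousOn_snd
  exact hc.comp hm fun p hp => ⟨hF (WhiteheadCW.Stage.map_mem_cellFrontier j hp.1), hp.2⟩

/-- The boundary lift `w ↦ gₙ(Φⱼ w)` over the boundary sphere of an `n`-cell is continuous.
[folklore] -/
theorem lift_continuousOn (s : Stage f u n) (j : cell (univ : Set K) n) :
    ContinuousOn (fun w : Fin n → ℝ => s.g (map n j w)) (sphere (0 : Fin n → ℝ) 1) := by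
  obtain ⟨F, hF, hg, -, -⟩ := s.exists_frontier_cover j
  exact hg.comp ((RelCWComplex.continuousOn n j).mono sphere_subset_closedBall)
    fun w hw => hF (WhiteheadCW.Stage.map_mem_cellFrontier j hw)

omit [T2Space K] in
/-- The side data starts at `u ∘ Φⱼ`. [folklore] -/
theorem side_zero (s : Stage f u n) (j : cell (univ : Set K) n) :
    ∀ w ∈ sphere (0 : Fin n → ℝ) 1, s.H (map n j w) 0 = u (map n j w) :=
  fun _ _ => s.zero _

/-- The side data is stationary `= f ∘ gₙ ∘ Φⱼ` from time `WhiteheadCW.tau n` on. [folklore] -/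
theorem side_late (s : Stage f u n) (j : cell (univ : Set K) n) :
    ∀ w ∈ sphere (0 : Fin n → ℝ) 1, ∀ t ∈ Icc (WhiteheadCW.tau n) 1, s.H (map n j w) t = f (s.g (map n j w)) := by
  obtain ⟨F, hF, -, -, hl⟩ := s.exists_frontier_cover j
  exact fun w hw t ht => hl _ (hF (WhiteheadCW.Stage.map_mem_cellFrontier j hw)) t ht

/-- The extension of a stage-`n` lift-and-homotopy over (the characteristic cube of) an `n`-cell
exists, GIVEN `BallLift f n`. [folklore] -/
theorem exists_cellExt (hf : BallLift f n) (s : Stage f u n) (j : cell (univ : Set K) n) :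
    ∃ E : ((Fin n → ℝ) → X) × ((Fin n → ℝ) × ℝ → Y),
      ContinuousOn E.1 (closedBall (0 : Fin n → ℝ) 1) ∧
      (∀ w ∈ sphere (0 : Fin n → ℝ) 1, E.1 w = s.g (map n j w)) ∧
      ContinuousOn E.2 (closedBall (0 : Fin n → ℝ) 1 ×ˢ Icc (0 : ℝ) 1) ∧
      (∀ w ∈ closedBall (0 : Fin n → ℝ) 1, E.2 (w, 0) = u (map n j w)) ∧
      (∀ w ∈ sphere (0 : Fin n → ℝ) 1, ∀ t ∈ Icc (0 : ℝ) 1, E.2 (w, t) = s.H (map n j w) t) ∧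
      (∀ w ∈ closedBall (0 : Fin n → ℝ) 1, ∀ t ∈ Icc (WhiteheadCW.tau (n + 1)) 1, E.2 (w, t) = f (E.1 w)) := by
  obtain ⟨Ξ, G, h1, h2, h3, h4, h5, h6⟩ := exists_box_extension hf (WhiteheadCW.tau_pos n) (WhiteheadCW.tau_lt_succ n)
    (WhiteheadCW.tau_le_one (n + 1)) ((u.continuous.comp_continuousOn (RelCWComplex.continuousOn n j)))
    (s.side_continuousOn j) (s.side_zero j) (s.lift_continuousOn j) (s.side_late j)
  exact ⟨(Ξ, G), h1, h2, h3, h4, h5, h6⟩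

/-- A chosen extension (lift and homotopy) over the `n`-cell `j`. [folklore] -/
def cellExt (hf : BallLift f n) (s : Stage f u n) (j : cell (univ : Set K) n) :
    ((Fin n → ℝ) → X) × ((Fin n → ℝ) × ℝ → Y) :=
  (s.exists_cellExt hf j).choose

/-- The chosen lift is continuous on the closed ball. [folklore] -/
theorem cellExt_fst_continuousOn (hf : BallLift f n) (s : Stage f u n) (j : cell (univ : Set K) n) :
    ContinuousOn (s.cellExt hf j).1 (closedBall (0 : Fin n → ℝ) 1) :=
  (s.exists_cellExt hf j).choose_spec.1

/-- The chosen lift extends the old lift on the boundary sphere. [folklore] -/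
theorem cellExt_fst_sphere (hf : BallLift f n) (s : Stage f u n) (j : cell (univ : Set K) n)
    {w : Fin n → ℝ} (hw : w ∈ sphere (0 : Fin n → ℝ) 1) :
    (s.cellExt hf j).1 w = s.g (map n j w) :=
  (s.exists_cellExt hf j).choose_spec.2.1 w hw

/-- The chosen homotopy is continuous on the solid box. [folklore] -/
theorem cellExt_snd_continuousOn (hf : BallLift f n) (s : Stage f u n) (j : cell (univ : Set K) n) :
    ContinuousOn (s.cellExt hf j).2 (closedBall (0 : Fin n → ℝ) 1 ×ˢ Icc (0 : ℝ) 1) :=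
  (s.exists_cellExt hf j).choose_spec.2.2.1

/-- The chosen homotopy starts at `u ∘ Φⱼ`. [folklore] -/
theorem cellExt_snd_zero (hf : BallLift f n) (s : Stage f u n) (j : cell (univ : Set K) n)
    {w : Fin n → ℝ} (hw : w ∈ closedBall (0 : Fin n → ℝ) 1) :
    (s.cellExt hf j).2 (w, 0) = u (map n j w) :=
  (s.exists_cellExt hf j).choose_spec.2.2.2.1 w hw

/-- The chosen homotopy has the prescribed side values. [folklore] -/
theorem cellExt_snd_side (hf : BallLift f n) (s : Stage f u n) (j : cell (univ : Set K) n)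
    {w : Fin n → ℝ} (hw : w ∈ sphere (0 : Fin n → ℝ) 1) {t : ℝ} (ht : t ∈ Icc (0 : ℝ) 1) :
    (s.cellExt hf j).2 (w, t) = s.H (map n j w) t :=
  (s.exists_cellExt hf j).choose_spec.2.2.2.2.1 w hw t ht

/-- The chosen homotopy is stationary `= f ∘ Ξ` from time `WhiteheadCW.tau (n + 1)` on. [folklore] -/
theorem cellExt_snd_late (hf : BallLift f n) (s : Stage f u n) (j : cell (univ : Set K) n)
    {w : Fin n → ℝ} (hw : w ∈ closedBall (0 : Fin n → ℝ) 1) {t : ℝ}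
    (ht : t ∈ Icc (WhiteheadCW.tau (n + 1)) 1) :
    (s.cellExt hf j).2 (w, t) = f ((s.cellExt hf j).1 w) :=
  (s.exists_cellExt hf j).choose_spec.2.2.2.2.2 w hw t ht

/-! #### The next stage -/

/-- The lift of the next stage: on an open `n`-cell use the chosen lift, elsewhere keep the old
one. [folklore] -/
def nextG (hf : BallLift f n) (s : Stage f u n) (k : K) : X :=
  if hk : ∃ j : cell (univ : Set K) n, k ∈ openCell n j then
    (s.cellExt hf hk.choose).1 ((map n hk.choose).symm k)
  else s.g k

/-- The homotopy of the next stage: on an open `n`-cell use the chosen homotopy, elsewhere keep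
the old one. [folklore] -/
def nextH (hf : BallLift f n) (s : Stage f u n) (k : K) (t : ℝ) : Y :=
  if hk : ∃ j : cell (univ : Set K) n, k ∈ openCell n j then
    (s.cellExt hf hk.choose).2 ((map n hk.choose).symm k, t)
  else s.H k t

omit [T2Space K] in
/-- The open `n`-cell containing a point is the chosen one (open cells are disjoint).
[folklore] -/
theorem choose_eq {j : cell (univ : Set K) n} {k : K} (hk : k ∈ openCell n j)
    (hex : ∃ j : cell (univ : Set K) n, k ∈ openCell n j) : hex.choose = j := by
  by_contra hne
  have hne' : (⟨n, hex.choose⟩ : Σ n, cell (univ : Set K) n) ≠ ⟨n, j⟩ := fun h =>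
    hne (eq_of_heq (Sigma.mk.inj_iff.1 h).2)
  exact Set.disjoint_left.1 (disjoint_openCell_of_ne hne') hex.choose_spec hk

/-- On an open `n`-cell the next lift is the chosen lift of that cell. [folklore] -/
theorem nextG_of_mem_openCell (hf : BallLift f n) (s : Stage f u n) {j : cell (univ : Set K) n}
    {k : K} (hk : k ∈ openCell n j) :
    s.nextG hf k = (s.cellExt hf j).1 ((map n j).symm k) := by
  have hex : ∃ j : cell (univ : Set K) n, k ∈ openCell n j := ⟨j, hk⟩
  unfold nextG
  rw [dif_pos hex, choose_eq hk hex]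

/-- On an open `n`-cell the next homotopy is the chosen homotopy of that cell. [folklore] -/
theorem nextH_of_mem_openCell (hf : BallLift f n) (s : Stage f u n) {j : cell (univ : Set K) n}
    {k : K} (hk : k ∈ openCell n j) (t : ℝ) :
    s.nextH hf k t = (s.cellExt hf j).2 ((map n j).symm k, t) := by
  have hex : ∃ j : cell (univ : Set K) n, k ∈ openCell n j := ⟨j, hk⟩
  unfold nextH
  rw [dif_pos hex, choose_eq hk hex]

/-- Off the open `n`-cells the next lift is the old one. [folklore] -/
theorem nextG_of_not_mem (hf : BallLift f n) (s : Stage f u n) {k : K}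
    (hk : ¬ ∃ j : cell (univ : Set K) n, k ∈ openCell n j) : s.nextG hf k = s.g k := by
  unfold nextG
  rw [dif_neg hk]

/-- Off the open `n`-cells the next homotopy is the old one. [folklore] -/
theorem nextH_of_not_mem (hf : BallLift f n) (s : Stage f u n) {k : K}
    (hk : ¬ ∃ j : cell (univ : Set K) n, k ∈ openCell n j) (t : ℝ) : s.nextH hf k t = s.H k t := by
  unfold nextH
  rw [dif_neg hk]

/-- On the characteristic cube of the `n`-cell `j`, the next lift is the chosen lift.
[folklore] -/
theorem nextG_map (hf : BallLift f n) (s : Stage f u n) (j : cell (univ : Set K) n)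
    {w : Fin n → ℝ} (hw : w ∈ closedBall (0 : Fin n → ℝ) 1) :
    s.nextG hf (map n j w) = (s.cellExt hf j).1 w := by
  rcases (mem_closedBall_zero_iff.1 hw).lt_or_eq with h1 | h1
  · have hwb : w ∈ ball (0 : Fin n → ℝ) 1 := mem_ball_zero_iff.2 h1
    have hx : map n j w ∈ openCell n j := ⟨w, hwb, rfl⟩
    rw [s.nextG_of_mem_openCell hf hx, (map n j).left_inv (by rw [source_eq]; exact hwb)]
  · have hws : w ∈ sphere (0 : Fin n → ℝ) 1 := mem_sphere_zero_iff_norm.2 h1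
    rw [s.nextG_of_not_mem hf (WhiteheadCW.Stage.not_mem_openCell_of_mem_cellFrontier
      (WhiteheadCW.Stage.map_mem_cellFrontier j hws)), s.cellExt_fst_sphere hf j hws]

/-- On the characteristic cube of the `n`-cell `j`, the next homotopy is the chosen homotopy.
[folklore] -/
theorem nextH_map (hf : BallLift f n) (s : Stage f u n) (j : cell (univ : Set K) n)
    {w : Fin n → ℝ} (hw : w ∈ closedBall (0 : Fin n → ℝ) 1) {t : ℝ} (ht : t ∈ Icc (0 : ℝ) 1) :
    s.nextH hf (map n j w) t = (s.cellExt hf j).2 (w, t) := by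
  rcases (mem_closedBall_zero_iff.1 hw).lt_or_eq with h1 | h1
  · have hwb : w ∈ ball (0 : Fin n → ℝ) 1 := mem_ball_zero_iff.2 h1
    have hx : map n j w ∈ openCell n j := ⟨w, hwb, rfl⟩
    rw [s.nextH_of_mem_openCell hf hx, (map n j).left_inv (by rw [source_eq]; exact hwb)]
  · have hws : w ∈ sphere (0 : Fin n → ℝ) 1 := mem_sphere_zero_iff_norm.2 h1
    rw [s.nextH_of_not_mem hf (WhiteheadCW.Stage.not_mem_openCell_of_mem_cellFrontier
      (WhiteheadCW.Stage.map_mem_cellFrontier j hws)), s.cellExt_snd_side hf j hws ht]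

/-- The characteristic map of a compact cube onto a (Hausdorff) closed cell is a quotient map, so
a function on the closed cell is continuous iff its composite with the characteristic map is
continuous on the closed ball. [folklore] -/
theorem continuousOn_closedCell_of_comp_map {Z : Type*} [TopologicalSpace Z]
    (j : cell (univ : Set K) n) {F : K → Z}
    (hF : ContinuousOn (fun w => F (map n j w)) (closedBall (0 : Fin n → ℝ) 1)) :
    ContinuousOn F (closedCell n j) := by
  rw [continuousOn_iff_continuous_restrict]
  have hAc : CompactSpace ↥(closedBall (0 : Fin n → ℝ) 1) :=
    isCompact_iff_compactSpace.mp (isCompact_closedBall _ _)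
  let Φ : ↥(closedBall (0 : Fin n → ℝ) 1) → ↥(closedCell n j) :=
    fun p => ⟨map n j p.1, ⟨p.1, p.2, rfl⟩⟩
  have hΦc : Continuous Φ :=
    ((RelCWComplex.continuousOn n j).comp_continuous continuous_subtype_val
      fun p => p.2).subtype_mk _
  have hΦs : Function.Surjective Φ := by
    rintro ⟨x, ⟨w, hw, hwx⟩⟩
    exact ⟨⟨w, hw⟩, Subtype.ext hwx⟩
  have hΦq : IsQuotientMap Φ := hΦc.isClosedMap.isQuotientMap hΦc hΦs
  rw [hΦq.continuous_iff]
  exact hF.comp_continuous continuous_subtype_val fun p => p.2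

/-- Same for functions on `closed cell × [0, 1]`. [folklore] -/
theorem continuousOn_closedCell_prod_of_comp_map {Z : Type*} [TopologicalSpace Z]
    (j : cell (univ : Set K) n) {F : K × ℝ → Z}
    (hF : ContinuousOn (fun p : (Fin n → ℝ) × ℝ => F (map n j p.1, p.2))
      (closedBall (0 : Fin n → ℝ) 1 ×ˢ Icc (0 : ℝ) 1)) :
    ContinuousOn F (closedCell n j ×ˢ Icc (0 : ℝ) 1) := by
  rw [continuousOn_iff_continuous_restrict]
  have hAc : CompactSpace ↥(closedBall (0 : Fin n → ℝ) 1 ×ˢ Icc (0 : ℝ) 1) :=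
    isCompact_iff_compactSpace.mp ((isCompact_closedBall _ _).prod isCompact_Icc)
  let Φ : ↥(closedBall (0 : Fin n → ℝ) 1 ×ˢ Icc (0 : ℝ) 1) → ↥(closedCell n j ×ˢ Icc (0 : ℝ) 1) :=
    fun p => ⟨(map n j p.1.1, p.1.2), ⟨p.1.1, p.2.1, rfl⟩, p.2.2⟩
  have hΦc : Continuous Φ := by
    refine Continuous.subtype_mk
      (Continuous.prodMk ?_ (continuous_snd.comp continuous_subtype_val)) _
    exact (RelCWComplex.continuousOn n j).comp_continuous
      (continuous_fst.comp continuous_subtype_val) fun p => p.2.1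
  have hΦs : Function.Surjective Φ := by
    rintro ⟨⟨x, t⟩, ⟨w, hw, hwx⟩, ht⟩
    exact ⟨⟨(w, t), hw, ht⟩, Subtype.ext (Prod.ext hwx rfl)⟩
  have hΦq : IsQuotientMap Φ := hΦc.isClosedMap.isQuotientMap hΦc hΦs
  rw [hΦq.continuous_iff]
  exact hF.comp_continuous continuous_subtype_val fun p => p.2

/-- The next lift is continuous on each closed `n`-cell. [folklore] -/
theorem nextG_continuousOn_top (hf : BallLift f n) (s : Stage f u n)
    (j : cell (univ : Set K) n) : ContinuousOn (s.nextG hf) (closedCell n j) :=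
  continuousOn_closedCell_of_comp_map j
    ((s.cellExt_fst_continuousOn hf j).congr fun _ hw => s.nextG_map hf j hw)

/-- The next homotopy is continuous on each closed `n`-cell (times `[0, 1]`). [folklore] -/
theorem nextH_continuousOn_top (hf : BallLift f n) (s : Stage f u n)
    (j : cell (univ : Set K) n) :
    ContinuousOn (fun p : K × ℝ => s.nextH hf p.1 p.2) (closedCell n j ×ˢ Icc (0 : ℝ) 1) :=
  continuousOn_closedCell_prod_of_comp_map j
    ((s.cellExt_snd_continuousOn hf j).congr fun _ hp => s.nextH_map hf j hp.1 hp.2)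

/-- **The inductive step**: a stage-`n` lift-and-homotopy extends to stage `n + 1`, GIVEN
`BallLift f n`. [folklore] -/
def next (hf : BallLift f n) (s : Stage f u n) : Stage f u (n + 1) where
  g := s.nextG hf
  H := s.nextH hf
  cont_g m hm j := by
    rcases (Nat.lt_succ_iff.1 hm).lt_or_eq with hmn | rfl
    · exact (s.cont_g m hmn j).congr fun k hk =>
        s.nextG_of_not_mem hf (WhiteheadCW.Stage.not_mem_openCell_of_mem_closedCell hmn hk)
    · exact s.nextG_continuousOn_top hf j
  cont m hm j := by
    rcases (Nat.lt_succ_iff.1 hm).lt_or_eq with hmn | rfl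
    · exact (s.cont m hmn j).congr fun p hp =>
        s.nextH_of_not_mem hf (WhiteheadCW.Stage.not_mem_openCell_of_mem_closedCell hmn hp.1) p.2
    · exact s.nextH_continuousOn_top hf j
  zero k := by
    by_cases hk : ∃ j : cell (univ : Set K) n, k ∈ openCell n j
    · obtain ⟨j, hkj⟩ := hk
      obtain ⟨w, hw, rfl⟩ := openCell_subset_closedCell n j hkj
      rw [s.nextH_map hf j hw ⟨le_rfl, zero_le_one⟩, s.cellExt_snd_zero hf j hw]
    · rw [s.nextH_of_not_mem hf hk]
      exact s.zero k
  late m hm j k hk t ht := by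
    rcases (Nat.lt_succ_iff.1 hm).lt_or_eq with hmn | rfl
    · have hk' := WhiteheadCW.Stage.not_mem_openCell_of_mem_closedCell hmn hk
      rw [s.nextH_of_not_mem hf hk', s.nextG_of_not_mem hf hk']
      exact s.late m hmn j k hk t ht
    · obtain ⟨w, hw, rfl⟩ := hk
      rw [s.nextH_map hf j hw ⟨(WhiteheadCW.tau_pos (m + 1)).le.trans ht.1, ht.2⟩,
        s.cellExt_snd_late hf j hw ht, s.nextG_map hf j hw]

/-- The lift of the next stage is `nextG`. [folklore] -/
@[simp] theorem next_g (hf : BallLift f n) (s : Stage f u n) : (s.next hf).g = s.nextG hf := rfl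

/-- The homotopy of the next stage is `nextH`. [folklore] -/
@[simp] theorem next_H (hf : BallLift f n) (s : Stage f u n) : (s.next hf).H = s.nextH hf := rfl

end Stage

/-! #### All stages, and the limit -/

section Limit

variable [Nonempty X] (u : C(K, Y)) (hf : ∀ n, BallLift f n)

/-- The sequence of stages, by recursion. [folklore] -/
def stages : (n : ℕ) → Stage f u n
  | 0 => stageZero f u
  | n + 1 => (stages n).next (hf n)

/-- Once the open cell of a point has been treated, the lift at that point never changes.
[folklore] -/
theorem stages_g_eq {d : ℕ} {i : cell (univ : Set K) d} {k : K}
    (hk : k ∈ openCell d i) {n : ℕ} (hn : d + 1 ≤ n) :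
    (stages u hf n).g k = (stages u hf (d + 1)).g k := by
  induction n, hn using Nat.le_induction with
  | base => rfl
  | succ n hn ih =>
    have hne : ¬ ∃ j : cell (univ : Set K) n, k ∈ openCell n j := by
      rintro ⟨j, hj⟩
      have hdn : (⟨d, i⟩ : Σ n, cell (univ : Set K) n) ≠ ⟨n, j⟩ := fun h => by
        have := (Sigma.mk.inj_iff.1 h).1; omega
      exact Set.disjoint_left.1 (disjoint_openCell_of_ne hdn) hk hj
    show ((stages u hf n).next (hf n)).g k = _
    rw [Stage.next_g, (stages u hf n).nextG_of_not_mem (hf n) hne, ih]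

/-- Once the open cell of a point has been treated, the homotopy at that point never changes.
[folklore] -/
theorem stages_H_eq {d : ℕ} {i : cell (univ : Set K) d} {k : K}
    (hk : k ∈ openCell d i) {n : ℕ} (hn : d + 1 ≤ n) :
    (stages u hf n).H k = (stages u hf (d + 1)).H k := by
  induction n, hn using Nat.le_induction with
  | base => rfl
  | succ n hn ih =>
    funext t
    have hne : ¬ ∃ j : cell (univ : Set K) n, k ∈ openCell n j := by
      rintro ⟨j, hj⟩
      have hdn : (⟨d, i⟩ : Σ n, cell (univ : Set K) n) ≠ ⟨n, j⟩ := fun h => by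
        have := (Sigma.mk.inj_iff.1 h).1; omega
      exact Set.disjoint_left.1 (disjoint_openCell_of_ne hdn) hk hj
    show ((stages u hf n).next (hf n)).H k t = _
    rw [Stage.next_H, (stages u hf n).nextH_of_not_mem (hf n) hne, ih]

/-- The limit lift: at `k`, the lift of the first stage which has treated `k`'s open cell.
[folklore] -/
def liftFun (k : K) : X := (stages u hf (WhiteheadCW.dimOf k + 1)).g k

/-- The limit homotopy. [folklore] -/
def homFun (k : K) (t : ℝ) : Y := (stages u hf (WhiteheadCW.dimOf k + 1)).H k t

omit [Nonempty X] in
/-- The open cell containing a point of a closed `m`-cell has dimension `≤ m`. [folklore] -/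
theorem dimOf_le {m : ℕ} {j : cell (univ : Set K) m} {k : K} (hk : k ∈ closedCell m j) :
    WhiteheadCW.dimOf k ≤ m := by
  obtain ⟨i, hi⟩ := WhiteheadCW.exists_mem_openCell_dimOf k
  have hsk : k ∈ (skeleton (univ : Set K) (m : ℕ∞) : Set K) := closedCell_subset_skeleton m j hk
  obtain ⟨d', hd', i', hi'⟩ := CWComplex.mem_skeleton_iff.1 hsk
  have hdd' : (⟨WhiteheadCW.dimOf k, i⟩ : Σ n, cell (univ : Set K) n) = ⟨d', i'⟩ :=
    eq_of_not_disjoint_openCell fun h => Set.disjoint_left.1 h hi hi'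
  have h1 : WhiteheadCW.dimOf k = d' := (Sigma.mk.inj_iff.1 hdd').1
  rw [h1]; exact_mod_cast hd'

/-- On a closed `m`-cell the limit lift is the stage-`(m+1)` lift. [folklore] -/
theorem liftFun_eq_of_mem_closedCell {m : ℕ} {j : cell (univ : Set K) m} {k : K}
    (hk : k ∈ closedCell m j) : liftFun u hf k = (stages u hf (m + 1)).g k := by
  obtain ⟨i, hi⟩ := WhiteheadCW.exists_mem_openCell_dimOf k
  have hd := dimOf_le hk
  exact (stages_g_eq u hf hi (by omega : WhiteheadCW.dimOf k + 1 ≤ m + 1)).symm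

/-- On a closed `m`-cell the limit homotopy is the stage-`(m+1)` homotopy. [folklore] -/
theorem homFun_eq_of_mem_closedCell {m : ℕ} {j : cell (univ : Set K) m} {k : K}
    (hk : k ∈ closedCell m j) : homFun u hf k = (stages u hf (m + 1)).H k := by
  obtain ⟨i, hi⟩ := WhiteheadCW.exists_mem_openCell_dimOf k
  have hd := dimOf_le hk
  exact (stages_H_eq u hf hi (by omega : WhiteheadCW.dimOf k + 1 ≤ m + 1)).symm

/-- The limit lift is continuous on every closed cell. [folklore] -/
theorem liftFun_continuousOn {m : ℕ} (j : cell (univ : Set K) m) :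
    ContinuousOn (liftFun u hf) (closedCell m j) :=
  ((stages u hf (m + 1)).cont_g m (lt_add_one m) j).congr fun _ hk =>
    liftFun_eq_of_mem_closedCell u hf hk

/-- The limit homotopy is continuous on every closed cell (times `[0, 1]`). [folklore] -/
theorem homFun_continuousOn {m : ℕ} (j : cell (univ : Set K) m) :
    ContinuousOn (fun p : K × ℝ => homFun u hf p.1 p.2) (closedCell m j ×ˢ Icc (0 : ℝ) 1) :=
  ((stages u hf (m + 1)).cont m (lt_add_one m) j).congr fun p hp => by
    show homFun u hf p.1 p.2 = _; rw [homFun_eq_of_mem_closedCell u hf hp.1]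

/-- The limit homotopy starts at `u`. [folklore] -/
theorem homFun_zero (k : K) : homFun u hf k 0 = u k :=
  (stages u hf (WhiteheadCW.dimOf k + 1)).zero k

/-- The limit homotopy ends at `f ∘ liftFun` (all `τₙ < 1`). [folklore] -/
theorem homFun_one (k : K) : homFun u hf k 1 = f (liftFun u hf k) := by
  obtain ⟨i, hi⟩ := WhiteheadCW.exists_mem_openCell_dimOf k
  exact (stages u hf (WhiteheadCW.dimOf k + 1)).late _ (lt_add_one _) i k
    (openCell_subset_closedCell _ _ hi) 1 ⟨WhiteheadCW.tau_le_one _, le_rfl⟩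

/-- **The limit lift** as a continuous map (weak topology). [folklore] -/
def lift : C(K, X) :=
  ⟨liftFun u hf, WhiteheadCW.continuous_of_continuousOn_closedCell fun _ j =>
    liftFun_continuousOn u hf j⟩

/-- The limit homotopy, curried: a continuous path-valued map on `K`. [folklore] -/
def limPath (k : K) : C(I, Y) where
  toFun t := homFun u hf k t
  continuous_toFun := by
    obtain ⟨i, hi⟩ := WhiteheadCW.exists_mem_openCell_dimOf k
    exact (homFun_continuousOn u hf i).comp_continuous (f := fun t : I => (k, (t : ℝ)))
      (by fun_prop) fun t => ⟨openCell_subset_closedCell _ _ hi, t.2⟩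

/-- The curried limit homotopy is continuous: on each closed cell by construction, hence on `K`
by the weak topology. [folklore] -/
theorem continuous_limPath : Continuous (limPath u hf) := by
  refine WhiteheadCW.continuous_of_continuousOn_closedCell fun n j => ?_
  refine ContinuousMap.continuousOn_of_continuousOn_uncurry _ ?_
  exact (homFun_continuousOn u hf j).comp ((continuousOn_fst).prodMk
    (continuous_subtype_val.comp_continuousOn continuousOn_snd)) fun p hp => ⟨hp.1, p.2.2⟩

/-- **The limit homotopy** from `u` to `f ∘ lift`. [folklore] -/
def liftHomotopy : u.Homotopy (f.comp (lift u hf)) where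
  toFun p := limPath u hf p.2 p.1
  continuous_toFun :=
    (ContinuousMap.continuous_uncurry_of_continuous ⟨limPath u hf, continuous_limPath u hf⟩).comp
      continuous_swap
  map_zero_left k := homFun_zero u hf k
  map_one_left k := homFun_one u hf k

end Limit

end CW

/-- **Maps out of CW complexes lift, up to homotopy, through a map that lifts all balls**
(Hatcher 2002, proof of Prop. 4.22 by the compression lemma 4.6: for a weak homotopy equivalence
`f`, `f ∘ - : [K, X] → [K, Y]` is onto for every CW complex `K`; here with the lifting property
`BallLift f n` for all `n` as the hypothesis, which is what the cell-by-cell argument uses).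
PROVED: for `K` a Hausdorff space with a classical CW structure `Topology.CWComplex univ`,
`f : C(X, Y)` with `X` nonempty and `BallLift f n` for all `n`, and any `u : C(K, Y)`, there is
`g : C(K, X)` with `u` homotopic to `f ∘ g`. (For `X = ∅` the hypothesis is vacuous and the
conclusion fails unless `K = ∅`.) [cite: HatcherAT2002, §4.1 Lemma 4.6 and Prop. 4.22] -/
theorem exists_lift_homotopic {K : Type*} [TopologicalSpace K] [T2Space K]
    [CWComplex (univ : Set K)] [Nonempty X] (f : C(X, Y)) (hf : ∀ n, BallLift f n)
    (u : C(K, Y)) : ∃ g : C(K, X), u.Homotopic (f.comp g) :=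
  ⟨lift u hf, ⟨liftHomotopy u hf⟩⟩

end CWLift

end Literature.AlgebraicTopology.Homotopy

end
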